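import Summits.Langlands.Langlands.Theorems.SoloInformedFrobBmaxPlusInjective
import Summits.Langlands.Langlands.Theorems.SoloInformedRepairD2CrisCharpoly

/-!
# `φ` is injective on `B_max(F)`, hence `φ_D` is injective on `D_cris(ρ_v)` (solo programme, s78)

From `frobBmaxPlus_injective` (`φ` injective on `A_max`): `φ` is injective on `B_max(F) = A_max[1/t]`
(`A_max → A_max[1/t]` is injective as `t` is a non-zero-divisor, and `φ(t) = pt`), so `φ_D = (1 ⊗ φ)|_{D_cris}` is
injective on `D_cris(ρ_v)` for every `p`-adic representation `ρ_v` of `Γ_F` — discharging the hypothesis `hφ` of the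
`D_cris` charpoly ladder (`exists_charpoly_phiDcris_pow_eq_pow hq ρv (phiDcris_injective hF ρv)`).
[cite: Colmez1998Annals, §III.2]
-/

noncomputable section

open WittVector Field
open Literature.NumberTheory.PAdicHodge
open Literature.NumberTheory.GaloisRepresentations
open Literature.NumberTheory.GaloisRepresentations.IsNonarchimedeanLocalField
open Summit.Langlands.Langlands.Theorems.AinfDigits

namespace Summit.Langlands.Langlands.Theorems.D2Cris

variable {F : Type} [Field F] [ValuativeRel F] [TopologicalSpace F] [IsNonarchimedeanLocalField F]
  [CharZero F] {p : ℕ} [Fact p.Prime] [Fact (¬ IsUnit (p : integerC F))]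
  [IsAdicComplete (Ideal.span {(p : integerC F)}) (integerC F)]

/-- **`φ` is injective on `B_max(F) = A_max[1/t]`** (for `θ_F` surjective): `φ` is injective on `A_max`
(`frobBmaxPlus_injective`), `A_max → A_max[1/t]` is injective (`t` is a non-zero-divisor) and `t` is a unit of
`A_max[1/t]`. [cite: Colmez1998Annals, §III.2] -/
theorem frobBmax_injective (hF : Function.Surjective (fontaineTheta (integerC F) p)) :
    Function.Injective (frobBmax F p) := by
  have ht : tBmax (F := F) (p := p) ∈ nonZeroDivisors (BmaxPlus F p) :=
    mem_nonZeroDivisors_iff.2 ⟨fun z hz => eq_zero_of_tBmax_mul_eq_zero hF hz,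
      fun z hz => eq_zero_of_tBmax_mul_eq_zero hF (by rwa [mul_comm] at hz)⟩
  have hinj : Function.Injective (algebraMap (BmaxPlus F p) (Bmax F p)) :=
    IsLocalization.injective (M := Submonoid.powers (tBmax (F := F) (p := p))) (Bmax F p) ((Submonoid.powers_le).2 ht)
  refine (injective_iff_map_eq_zero _).2 fun x hx => ?_
  obtain ⟨⟨a, s, hs⟩, hax⟩ := IsLocalization.surj (Submonoid.powers (tBmax (F := F) (p := p))) x
  obtain ⟨k, rfl⟩ := (Submonoid.mem_powers_iff _ _).1 hs
  dsimp only at hax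
  have h1 : algebraMap (BmaxPlus F p) (Bmax F p) (frobBmaxPlus F p a) = 0 := by
    rw [← frobBmax_algebraMap, ← hax, map_mul, hx, zero_mul]
  have h2 : a = 0 :=
    (injective_iff_map_eq_zero _).1 (frobBmaxPlus_injective hF) a (hinj (by rw [h1, map_zero]))
  have h3 : x * algebraMap (BmaxPlus F p) (Bmax F p) (tBmax ^ k) = 0 := by rw [hax, h2, map_zero]
  rw [map_pow] at h3
  exact ((isUnit_algebraMap_tBmax (F := F) (p := p)).pow k).mul_left_eq_zero.1 h3

/-- ★ **`φ_D` is injective on `D_cris(ρ_v)`** for every `p`-adic representation `ρ_v` of `Γ_F` (given `θ_F`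
surjective, e.g. `‖p‖_F < 1`): the hypothesis `hφ` of the `D_cris` charpoly ladder, discharged. [cite: Colmez1998Annals, §III.2] -/
theorem phiDcris_injective (hF : Function.Surjective (fontaineTheta (integerC F) p)) {m : ℕ}
    (ρv : FramedRep (absoluteGaloisGroup F) (PadicAlgCl p) m) :
    Function.Injective (phiDcris (F := F) (p := p) ρv) :=
  phiDcris_injective_of_frobBmax_injective ρv (frobBmax_injective hF)

end Summit.Langlands.Langlands.Theorems.D2Cris
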